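import Mathlib
import Summits.Ventures.PercRepro2.SwOutJunction
import Summits.Ventures.PercRepro2.SwOutNeverCoreAsym

/-!
# The junction theorem on the asymmetric side (blind cell PercRepro2, night-4 g30, 2026-08-28;
proofs/NIGHT4-G30.md §7)

g11's junction theorem (`rigidOK_of_junction`: a region with ONE junction `u` — no loop, no outside
edge, every neighbour `p ≠ h` of `u` adjacent to `h` — and every other vertex with an outside edge
or no edge) enters the conditioning `Q` in two places: the mark's exemption from the outside-edge
hypothesis (a core at `o ∈ C_R(l)` joins `h` to `l`) and the TRANSPORT of `Q` to the graph split
at `u` on the split-fine configurations (`mem_tgtU_split_of_mem`, `mem_tgtU_of_mem_split`).  On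
the asymmetric side `T(𝓤₁, 𝓤₂)` the exemption goes to the vertices forced by `𝓤₁` (predicate
`F`), and the up-sets pull back along `Sum.inl : V → V ⊕ E` (`pullInl`): the clusters of `l` in
the split graph, read on `inl`, are the clusters of `l` (`mem_tgtU2_split_of_mem`,
`mem_tgtU2_of_mem_split`).  Everything else is g11's proof verbatim with `card_orbit_le2` in place
of `card_orbit_le`: **`rigidOK2_of_junction`** (every class), **`swAll2_of_junction`** (the
whole graph: the asymmetric domination on every graph with one junction in the region `{l}ᶜ`,
for every pair of up-sets — g11's class).
-/

namespace Summit.Ventures.PercRepro2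

namespace LocRows

open Hull

variable {V : Type*} {E : Type*} [Fintype E] [DecidableEq E]

open scoped Classical

variable {ends : E → Sym2 V} {U : Set V} {ξ : Config E} {l h u : V} {𝓤₁ 𝓤₂ : Set (Set V)}

section Pull

variable (E)

/-- The pull-back of a family of vertex sets along `Sum.inl : V → V ⊕ E`. -/
def pullInl (𝓤 : Set (Set V)) : Set (Set (V ⊕ E)) := {S' | {x | Sum.inl x ∈ S'} ∈ 𝓤}

variable {E}

omit [Fintype E] [DecidableEq E] in
/-- The pull-back of an up-set is an up-set. -/
lemma isUpperSet_pullInl {𝓤 : Set (Set V)} (h𝓤 : IsUpperSet 𝓤) :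
    IsUpperSet (pullInl E 𝓤) :=
  fun _ _ hST hS => h𝓤 (fun _ hx => hST hx) hS

omit [Fintype E] [DecidableEq E] in
/-- On a split-fine configuration whose red cluster of `l` avoids `h`, the red cluster of `l` in
the split graph, read on `inl`, is the red cluster of `l`. -/
lemma setOf_inl_mem_cluster_split (hloop : ∀ e, ends e ≠ s(u, u)) (hlu : l ≠ u) {η : Config E}
    (hf : SplitFine ends u h η) (hhl : Sum.inl h ∉ cluster (splitEnds ends u) η (Sum.inl l)) :
    {x | Sum.inl x ∈ cluster (splitEnds ends u) η (Sum.inl l)} = cluster ends η l :=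
  Set.Subset.antisymm (fun _ hx => conn_of_conn_split_inl hx)
    (cluster_l_subset_split_of_splitFine hloop hlu hf hhl)

/-- **The asymmetric side passes to the split** on split-fine configurations. -/
theorem mem_tgtU2_split_of_mem (hloop : ∀ e, ends e ≠ s(u, u)) (hlu : l ≠ u) {η : Config E}
    (hf : SplitFine ends u h η) (hQ : η ∈ tgtU2 ends l h 𝓤₁ 𝓤₂) :
    η ∈ tgtU2 (splitEnds ends u) (Sum.inl l) (Sum.inl h) (pullInl E 𝓤₁) (pullInl E 𝓤₂) := by
  rw [mem_tgtU2] at hQ ⊢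
  obtain ⟨hhl, hA, hB⟩ := hQ
  have hhA' : Sum.inl h ∉ cluster (splitEnds ends u) η (Sum.inl l) :=
    fun h' => hhl (Or.inl (conn_of_conn_split_inl h'))
  have hhB' : Sum.inl h ∉ cluster (splitEnds ends u) (blue η) (Sum.inl l) :=
    fun h' => hhl (Or.inr (conn_of_conn_split_inl h'))
  refine ⟨?_, ?_, ?_⟩
  · rintro (h1 | h1)
    · exact hhA' h1
    · exact hhB' h1
  · show {x | Sum.inl x ∈ cluster (splitEnds ends u) η (Sum.inl l)} ∈ 𝓤₁
    rw [setOf_inl_mem_cluster_split hloop hlu hf hhA']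
    exact hA
  · show {x | Sum.inl x ∈ cluster (splitEnds ends u) (blue η) (Sum.inl l)} ∉ 𝓤₂
    rw [setOf_inl_mem_cluster_split hloop hlu (splitFine_blue_iff.2 hf) hhB']
    exact hB

/-- **The asymmetric side comes back from the split** on split-fine configurations. -/
theorem mem_tgtU2_of_mem_split (hloop : ∀ e, ends e ≠ s(u, u)) (hlu : l ≠ u) {η : Config E}
    (hf : SplitFine ends u h η)
    (hQ : η ∈ tgtU2 (splitEnds ends u) (Sum.inl l) (Sum.inl h) (pullInl E 𝓤₁) (pullInl E 𝓤₂)) :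
    η ∈ tgtU2 ends l h 𝓤₁ 𝓤₂ := by
  rw [mem_tgtU2] at hQ ⊢
  obtain ⟨hhl, hA, hB⟩ := hQ
  have hhA' : Sum.inl h ∉ cluster (splitEnds ends u) η (Sum.inl l) := fun h' => hhl (Or.inl h')
  have hhB' : Sum.inl h ∉ cluster (splitEnds ends u) (blue η) (Sum.inl l) :=
    fun h' => hhl (Or.inr h')
  have eA := setOf_inl_mem_cluster_split hloop hlu hf hhA'
  have eB := setOf_inl_mem_cluster_split hloop hlu (splitFine_blue_iff.2 hf) hhB'
  refine ⟨?_, ?_, ?_⟩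
  · rintro (h1 | h1)
    · rw [← eA] at h1
      exact hhA' h1
    · rw [← eB] at h1
      exact hhB' h1
  · rw [← eA]
    exact hA
  · rw [← eB]
    exact hB

end Pull

/-! ## Cores at the junction only -/

section Core

variable {F : V → Prop}

/-- When every vertex of `U ∖ {h, u}` is forced, or has an outside edge, or no edge, every core
of a `T`-configuration is `h` or `u`. -/
theorem core_eq_h_or_u2 (hF : ∀ x, F x → ∀ S ∈ 𝓤₁, x ∈ S)
    (hout : ∀ x ∈ U, x ≠ h → x ≠ u →
      F x ∨ (∃ e y, ends e = s(x, y) ∧ y ∉ U) ∨ (∀ e, x ∉ ends e))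
    {ζ : Config E} (hζ : ζ ∈ swOutSide2 ends l h 𝓤₁ 𝓤₂ U ξ) {x : V}
    (hxT : x ∈ cluster ends ζ h) (hxTp : x ∈ cluster ends (blue ζ) h) : x = h ∨ x = u := by
  by_cases hxh : x = h
  · exact Or.inl hxh
  by_cases hxu : x = u
  · exact Or.inr hxu
  exfalso
  have hQ := (mem_swOutSide2.1 hζ).1
  have hcl := (mem_swOutSide2.1 hζ).2
  rw [mem_tgtU2] at hQ
  obtain ⟨hhl, hA, _⟩ := hQ
  have hhA : h ∉ cluster ends ζ l := fun h' => hhl (Or.inl h')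
  have hxU : x ∈ U := (mem_outClass.1 hcl).2 (Or.inl hxT)
  rcases hout x hxU hxh hxu with hf | ⟨e, y, hxy, hyU⟩ | hiso
  · exact hhA (conn_trans (hF x hf _ hA) (conn_symm hxT))
  · cases he : ζ e with
    | true => exact hyU ((mem_outClass.1 hcl).2 (Or.inl (mem_cluster_of_edge hxT he hxy)))
    | false =>
      have he' : blue ζ e = true := by rw [blue_eq_true_iff]; exact he
      exact hyU ((mem_outClass.1 hcl).2 (Or.inr (mem_cluster_of_edge hxTp he' hxy)))
  · obtain ⟨e, hxe⟩ := exists_edge_of_mem_cluster hxT hxh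
    exact hiso e hxe

/-- A split-fine `T`-configuration is core-free in the split graph. -/
theorem coreFree_split_of_splitFine2 (hF : ∀ x, F x → ∀ S ∈ 𝓤₁, x ∈ S)
    (hloop : ∀ e, ends e ≠ s(u, u)) (hhu : h ≠ u)
    (hout : ∀ x ∈ U, x ≠ h → x ≠ u →
      F x ∨ (∃ e y, ends e = s(x, y) ∧ y ∉ U) ∨ (∀ e, x ∉ ends e))
    {ζ : Config E} (hζ : ζ ∈ swOutSide2 ends l h 𝓤₁ 𝓤₂ U ξ) (hf : SplitFine ends u h ζ) :
    CoreFree (splitEnds ends u) ζ (Sum.inl h) := by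
  rintro (x | e) hxT hxTp
  · have h1 : x ∈ cluster ends ζ h := conn_of_conn_split_inl hxT
    have h2 : x ∈ cluster ends (blue ζ) h := conn_of_conn_split_inl hxTp
    rcases core_eq_h_or_u2 hF hout hζ h1 h2 with rfl | rfl
    · rfl
    · exact absurd hxT (inl_u_notMem_cluster_split hloop hhu)
  · exfalso
    obtain ⟨_, h1, _⟩ := conn_of_conn_split_inr hxT
    obtain ⟨_, h2, _⟩ := conn_of_conn_split_inr hxTp
    rw [blue_eq_true_iff] at h2
    rw [h1] at h2
    exact absurd h2 (by simp)

/-- A `T`-configuration that is not split-fine is core-free. -/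
theorem coreFree_of_not_splitFine2 (hF : ∀ x, F x → ∀ S ∈ 𝓤₁, x ∈ S)
    (hloop : ∀ e, ends e ≠ s(u, u)) (hhu : h ≠ u)
    (hadj : ∀ e (he : u ∈ ends e), Sym2.Mem.other he ≠ h →
      ∃ e', ends e' = s(Sym2.Mem.other he, h))
    (hout : ∀ x ∈ U, x ≠ h → x ≠ u →
      F x ∨ (∃ e y, ends e = s(x, y) ∧ y ∉ U) ∨ (∀ e, x ∉ ends e))
    {ζ : Config E} (hζ : ζ ∈ swOutSide2 ends l h 𝓤₁ 𝓤₂ U ξ) (hnf : ¬ SplitFine ends u h ζ) :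
    CoreFree ends ζ h := by
  intro x hxT hxTp
  rcases core_eq_h_or_u2 hF hout hζ hxT hxTp with rfl | rfl
  · rfl
  · exfalso
    exact hnf (splitFine_of_matched hloop hhu hadj
      (fun y hy hy' => core_eq_h_or_u2 hF hout hζ hy hy') (matched_of_core hxT hxTp))

end Core

/-! ## The junction theorem on the asymmetric side -/

section Main

variable {F : V → Prop} (h𝓤₁ : IsUpperSet 𝓤₁) (h𝓤₂ : IsUpperSet 𝓤₂)
  (hF : ∀ x, F x → ∀ S ∈ 𝓤₁, x ∈ S)
  (hl : l ∉ U) (hloop_h : ∀ e, ends e ≠ s(h, h)) (hloop_u : ∀ e, ends e ≠ s(u, u))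
  (hu : u ∈ U) (hhu : h ≠ u)
  (hadj : ∀ e (he : u ∈ ends e), Sym2.Mem.other he ≠ h →
    ∃ e', ends e' = s(Sym2.Mem.other he, h))
  (hout : ∀ x ∈ U, x ≠ h → x ≠ u →
    F x ∨ (∃ e y, ends e = s(x, y) ∧ y ∉ U) ∨ (∀ e, x ∉ ends e))

include h𝓤₁ h𝓤₂ hF hl hloop_h hloop_u hu hhu hout in
/-- **The split-fine part**: orbit by orbit of the split graph's arm principle, asymmetric side. -/
theorem card_splitFine_le2 {𝓔 : Set (Set E)} (h𝓔 : IsUpperSet 𝓔) :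
    ((swOutSide2 ends l h 𝓤₁ 𝓤₂ U ξ).filter fun ζ =>
        redEdges ends ζ h ∈ 𝓔 ∧ SplitFine ends u h ζ).card ≤
      ((swOutSide2 ends l h 𝓤₁ 𝓤₂ U ξ).filter fun ζ =>
        blueEdges ends ζ h ∈ 𝓔 ∧ SplitFine ends u h ζ).card := by
  have hlu : l ≠ u := fun h' => hl (h' ▸ hu)
  have hl' := inl_notMem_splitRegion (V := V) (E := E) hl
  have hloop' := splitEnds_ne_loop_h (ends := ends) (u := u) hloop_h
  let can : Config E → Config E := fun ζ => allRed (splitEnds ends u) ζ (Sum.inl h)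
  let Fs : Finset (Config E) := (swOutSide2 ends l h 𝓤₁ 𝓤₂ U ξ).filter fun ζ => SplitFine ends u h ζ
  let S₀ : Finset (Config E) := Fs.image can
  have hmap : ∀ (P : Config E → Prop) (ζ : Config E),
      ζ ∈ (swOutSide2 ends l h 𝓤₁ 𝓤₂ U ξ).filter (fun ζ => P ζ ∧ SplitFine ends u h ζ) →
        can ζ ∈ S₀ := by
    intro P ζ hζ
    have hζ' := Finset.mem_filter.1 hζ
    exact Finset.mem_image_of_mem can (Finset.mem_filter.2 ⟨hζ'.1, hζ'.2.2⟩)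
  rw [Finset.card_eq_sum_card_fiberwise (hmap _), Finset.card_eq_sum_card_fiberwise (hmap _)]
  refine Finset.sum_le_sum fun ζ₀ hζ₀ => ?_
  obtain ⟨ζ₁, hζ₁, rfl⟩ := Finset.mem_image.1 hζ₀
  have hζ₁' := Finset.mem_filter.1 hζ₁
  have hSF₁ : SplitFine ends u h ζ₁ := hζ₁'.2
  have hc₁ : CoreFree (splitEnds ends u) ζ₁ (Sum.inl h) :=
    coreFree_split_of_splitFine2 hF hloop_u hhu hout hζ₁'.1 hSF₁
  have hcl₁ : ζ₁ ∈ outClass (splitEnds ends u) (splitRegion U) (Sum.inl h) ξ :=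
    mem_outClass_split_of_mem hu (mem_swOutSide2.1 hζ₁'.1).2
  have hc₀ : CoreFree (splitEnds ends u) (allRed (splitEnds ends u) ζ₁ (Sum.inl h)) (Sum.inl h) :=
    coreFree_allRed hc₁
  have hcl₀ : allRed (splitEnds ends u) ζ₁ (Sum.inl h) ∈
      outClass (splitEnds ends u) (splitRegion U) (Sum.inl h) ξ := allRed_mem_outClass hcl₁ hc₁
  have hfib : ∀ (P P' : Config E → Prop), (∀ ζ, SplitFine ends u h ζ → (P ζ ↔ P' ζ)) →
      ((swOutSide2 ends l h 𝓤₁ 𝓤₂ U ξ).filter (fun ζ => P ζ ∧ SplitFine ends u h ζ)).filter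
          (fun ζ => can ζ = can ζ₁) =
        (orbit (splitEnds ends u) (allRed (splitEnds ends u) ζ₁ (Sum.inl h)) (Sum.inl h)).filter
          fun ζ' => ζ' ∈ tgtU2 (splitEnds ends u) (Sum.inl l) (Sum.inl h)
            (pullInl E 𝓤₁) (pullInl E 𝓤₂) ∧ P' ζ' := by
    intro P P' hPP'
    ext ζ'
    simp only [Finset.mem_filter, orbit, Finset.mem_image, Finset.mem_univ, true_and, can]
    constructor
    · rintro ⟨⟨hζ', hP, hSF⟩, hcan⟩
      have hc' : CoreFree (splitEnds ends u) ζ' (Sum.inl h) :=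
        coreFree_split_of_splitFine2 hF hloop_u hhu hout hζ' hSF
      obtain ⟨ω, hω⟩ := exists_orbitReal_eq hc' hcan
      exact ⟨⟨ω, hω⟩, mem_tgtU2_split_of_mem hloop_u hlu hSF (mem_swOutSide2.1 hζ').1,
        (hPP' ζ' hSF).1 hP⟩
    · rintro ⟨⟨ω, rfl⟩, hQ', hP'⟩
      have hSF' : SplitFine ends u h
          (orbitReal (splitEnds ends u) (allRed (splitEnds ends u) ζ₁ (Sum.inl h)) (Sum.inl h) ω) := by
        intro e he
        rw [hull_orbitReal hc₀, hull_allRed hc₁]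
        exact hSF₁ e he
      have hcl' := orbitReal_mem_outClass hc₀ hcl₀ ω
      refine ⟨⟨mem_swOutSide2.2 ⟨mem_tgtU2_of_mem_split hloop_u hlu hSF' hQ',
        mem_outClass_of_mem_split hu hloop_u hhu hSF' hcl'⟩, (hPP' _ hSF').2 hP', hSF'⟩, ?_⟩
      rw [allRed_orbitReal hc₀ ω, allRed_idem hc₁]
  rw [hfib _ (fun ζ' => redEdges (splitEnds ends u) ζ' (Sum.inl h) ∈ 𝓔)
      (fun ζ hSF => by rw [redEdges_eq_of_splitFine hloop_u hhu hSF]),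
    hfib _ (fun ζ' => blueEdges (splitEnds ends u) ζ' (Sum.inl h) ∈ 𝓔)
      (fun ζ hSF => by rw [blueEdges_eq_of_splitFine hloop_u hhu hSF])]
  exact card_orbit_le2 hc₀ hloop' (isUpperSet_pullInl h𝓤₁) (isUpperSet_pullInl h𝓤₂) hcl₀ hl' h𝓔

include h𝓤₁ h𝓤₂ hF hloop_h hloop_u hhu hadj hout hl in
/-- **The non-split-fine part**: orbit by orbit of the graph's own arm principle, asymmetric
side. -/
theorem card_not_splitFine_le2 {𝓔 : Set (Set E)} (h𝓔 : IsUpperSet 𝓔) :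
    ((swOutSide2 ends l h 𝓤₁ 𝓤₂ U ξ).filter fun ζ =>
        redEdges ends ζ h ∈ 𝓔 ∧ ¬ SplitFine ends u h ζ).card ≤
      ((swOutSide2 ends l h 𝓤₁ 𝓤₂ U ξ).filter fun ζ =>
        blueEdges ends ζ h ∈ 𝓔 ∧ ¬ SplitFine ends u h ζ).card := by
  let can : Config E → Config E := fun ζ => allRed ends ζ h
  let Fs : Finset (Config E) :=
    (swOutSide2 ends l h 𝓤₁ 𝓤₂ U ξ).filter fun ζ => ¬ SplitFine ends u h ζ
  let S₀ : Finset (Config E) := Fs.image can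
  have hmap : ∀ (P : Config E → Prop) (ζ : Config E),
      ζ ∈ (swOutSide2 ends l h 𝓤₁ 𝓤₂ U ξ).filter (fun ζ => P ζ ∧ ¬ SplitFine ends u h ζ) →
        can ζ ∈ S₀ := by
    intro P ζ hζ
    have hζ' := Finset.mem_filter.1 hζ
    exact Finset.mem_image_of_mem can (Finset.mem_filter.2 ⟨hζ'.1, hζ'.2.2⟩)
  rw [Finset.card_eq_sum_card_fiberwise (hmap _), Finset.card_eq_sum_card_fiberwise (hmap _)]
  refine Finset.sum_le_sum fun ζ₀ hζ₀ => ?_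
  obtain ⟨ζ₁, hζ₁, rfl⟩ := Finset.mem_image.1 hζ₀
  have hζ₁' := Finset.mem_filter.1 hζ₁
  have hnf₁ : ¬ SplitFine ends u h ζ₁ := hζ₁'.2
  have hc₁ : CoreFree ends ζ₁ h :=
    coreFree_of_not_splitFine2 hF hloop_u hhu hadj hout hζ₁'.1 hnf₁
  have hcl₁ : ζ₁ ∈ outClass ends U h ξ := (mem_swOutSide2.1 hζ₁'.1).2
  have hc₀ : CoreFree ends (allRed ends ζ₁ h) h := coreFree_allRed hc₁
  have hcl₀ : allRed ends ζ₁ h ∈ outClass ends U h ξ := allRed_mem_outClass hcl₁ hc₁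
  have hnf₀ : ¬ SplitFine ends u h (allRed ends ζ₁ h) :=
    not_splitFine_flip hloop_u hhu hadj hc₁ (armClosed_blueSide hc₁) hnf₁
  have hfib : ∀ (P : Config E → Prop),
      ((swOutSide2 ends l h 𝓤₁ 𝓤₂ U ξ).filter (fun ζ => P ζ ∧ ¬ SplitFine ends u h ζ)).filter
          (fun ζ => can ζ = can ζ₁) =
        (orbit ends (allRed ends ζ₁ h) h).filter
          fun ζ' => ζ' ∈ tgtU2 ends l h 𝓤₁ 𝓤₂ ∧ P ζ' := by
    intro P
    ext ζ'
    simp only [Finset.mem_filter, orbit, Finset.mem_image, Finset.mem_univ, true_and, can]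
    constructor
    · rintro ⟨⟨hζ', hP, hnf⟩, hcan⟩
      have hc' : CoreFree ends ζ' h :=
        coreFree_of_not_splitFine2 hF hloop_u hhu hadj hout hζ' hnf
      obtain ⟨ω, hω⟩ := exists_orbitReal_eq hc' hcan
      exact ⟨⟨ω, hω⟩, (mem_swOutSide2.1 hζ').1, hP⟩
    · rintro ⟨⟨ω, rfl⟩, hQ, hP⟩
      have hnf' : ¬ SplitFine ends u h (orbitReal ends (allRed ends ζ₁ h) h ω) := by
        show ¬ SplitFine ends u h
          (flip ends (armsFalse ends (allRed ends ζ₁ h) h ω) (allRed ends (allRed ends ζ₁ h) h))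
        refine not_splitFine_flip hloop_u hhu hadj (coreFree_allRed hc₀)
          (armClosed_armsFalse_allRed hc₀ ω) ?_
        exact not_splitFine_flip hloop_u hhu hadj hc₀ (armClosed_blueSide hc₀) hnf₀
      refine ⟨⟨mem_swOutSide2.2 ⟨hQ, orbitReal_mem_outClass hc₀ hcl₀ ω⟩, hP, hnf'⟩, ?_⟩
      rw [allRed_orbitReal hc₀ ω, allRed_idem hc₁]
  rw [hfib, hfib]
  exact card_orbit_le2 hc₀ hloop_h h𝓤₁ h𝓤₂ hcl₀ hl h𝓔

include h𝓤₁ h𝓤₂ hF hl hloop_h hloop_u hu hhu hadj hout in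
/-- **THE JUNCTION THEOREM ON THE ASYMMETRIC SIDE**: the rigid counting inequality on
`T(𝓤₁, 𝓤₂)` of every class of a region with one junction `u` (no loop at `h` or `u`, `u` without
outside edge, every neighbour `p ≠ h` of `u` adjacent to `h`, every other vertex of `U ∖ {h}`
forced by `𝓤₁`, with an outside edge, or with no edge). -/
theorem rigidOK2_of_junction {𝓔 : Set (Set E)} (h𝓔 : IsUpperSet 𝓔) :
    ((swOutSide2 ends l h 𝓤₁ 𝓤₂ U ξ).filter fun ζ => redEdges ends ζ h ∈ 𝓔).card ≤
      ((swOutSide2 ends l h 𝓤₁ 𝓤₂ U ξ).filter fun ζ => blueEdges ends ζ h ∈ 𝓔).card := by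
  have hsplit : ∀ P : Config E → Prop,
      ((swOutSide2 ends l h 𝓤₁ 𝓤₂ U ξ).filter P).card =
        ((swOutSide2 ends l h 𝓤₁ 𝓤₂ U ξ).filter fun ζ => P ζ ∧ SplitFine ends u h ζ).card +
        ((swOutSide2 ends l h 𝓤₁ 𝓤₂ U ξ).filter fun ζ => P ζ ∧ ¬ SplitFine ends u h ζ).card := by
    intro P
    rw [← Finset.filter_filter, ← Finset.filter_filter,
      Finset.card_filter_add_card_filter_not]
  rw [hsplit, hsplit]
  exact Nat.add_le_add (card_splitFine_le2 h𝓤₁ h𝓤₂ hF hl hloop_h hloop_u hu hhu hout h𝓔)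
    (card_not_splitFine_le2 h𝓤₁ h𝓤₂ hF hl hloop_h hloop_u hhu hadj hout h𝓔)

end Main

section Graph

variable {F : V → Prop}

/-- **The asymmetric domination on every graph with one junction** `u ≠ l, h` in the region
`{l}ᶜ`: no loop at `h` or `u`, no edge `u–l`, every neighbour `p ≠ h` of `u` adjacent to `h`,
every other vertex forced by `𝓤₁`, joined to `l`, or isolated — for every pair of up-sets. -/
theorem swAll2_of_junction (hlh : l ≠ h) (hlu : l ≠ u) (hhu : h ≠ u)
    (hloop_h : ∀ e, ends e ≠ s(h, h)) (hloop_u : ∀ e, ends e ≠ s(u, u))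
    (h𝓤₁ : IsUpperSet 𝓤₁) (h𝓤₂ : IsUpperSet 𝓤₂) (hF : ∀ x, F x → ∀ S ∈ 𝓤₁, x ∈ S)
    (hadj : ∀ e (he : u ∈ ends e), Sym2.Mem.other he ≠ h →
      ∃ e', ends e' = s(Sym2.Mem.other he, h))
    (hout : ∀ x, x ≠ l → x ≠ h → x ≠ u →
      F x ∨ (∃ e, ends e = s(x, l)) ∨ (∀ e, x ∉ ends e)) :
    SwAll2 ends l h 𝓤₁ 𝓤₂ := by
  have _hlh := hlh
  refine exists_swAll_injection_of_card_le h _ (card_le_asym_of_classes hlh fun ξ 𝓔 h𝓔 => ?_)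
  refine rigidOK2_of_junction (ξ := ξ) (u := u) h𝓤₁ h𝓤₂ hF (by simp) hloop_h hloop_u
    (by simpa using hlu.symm) hhu hadj ?_ h𝓔
  intro x hx hxh hxu
  rcases hout x (by simpa using hx) hxh hxu with hf | ⟨e, he⟩ | hiso
  · exact Or.inl hf
  · exact Or.inr (Or.inl ⟨e, l, he, by simp⟩)
  · exact Or.inr (Or.inr hiso)

end Graph

end LocRows

end Summit.Ventures.PercRepro2
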